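import Literature.MathematicalPhysics.QuantumFieldTheory.LatticeLangevinDynamics
import Mathlib.Analysis.Convex.Hull
import Mathlib.Analysis.Normed.Algebra.Exponential
import Mathlib.Analysis.SpecialFunctions.Pow.Real
import Mathlib.MeasureTheory.Measure.Haar.OfBasis
import Mathlib.MeasureTheory.Integral.IntervalIntegral.Basic
import HarnessLib

/-!
# Chandra–Chevyrev–Hairer–Shen: the state space `Ω¹_α` of distributional connections on `𝕋²`
# and its space of gauge orbits `𝔒_α` (Publ. Math. IHÉS 136 (2022), §3 and Thm 2.1)

Cross-ladder literature typing (R141 (D) item (5); coordinator table `LIT-TYPING-TABLE` row 5,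
venue `CCHS2024/`). STATEMENTS ONLY: hypothesis-free definitions of the objects and the printed
theorems as named `Prop`s (no proofs; nothing here is a claim about the Yang–Mills mass gap).

Source: A. Chandra, I. Chevyrev, M. Hairer, H. Shen, *Langevin dynamic for the 2D Yang–Mills
measure*, Publ. Math. IHÉS 136 (2022) 1–147, arXiv:2006.04987 (held: `paper:arxiv-2006.04987`;
bib `ChandraChevyrevHairerShen2022YM2` = `ChandraEtAl2022`). Section 3 "Construction of the state
space" and Theorem 2.1. **Numbering.** Published / arXiv numbering = one shared counter per section
(Def. 3.1 is the first numbered item of §3); the held TeX-derived text layer prints per-kind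
counters instead (its "Definition 2", "Theorem 5", "Theorem 8" are Def. 3.1, Thm 3.11, Thm 3.45).
The map was fixed by counting the numbered environments of §§2–3 in the held text and anchored on
Chandra–Singh, *Rough geometric integration* (arXiv:2405.16615) Rem. 3.3 / Rem. 5.4 / §7, which cite
"[CCHS22, Def. 3.7]" (growth norm), "[CCHS22, Def. 3.10]", "Definition 3.16" (the control
`|γ;γ̄|_{α;[s,t]}`), "[CCHS22, Theorem 3.18]", "[CCHS22, Lemma 4.9]" — all consistent with the count.

## What is typed (print → Lean)

* §1.5, §3.1: the torus `𝕋² = ℝ²/ℤ²` through its universal cover (`E2`, `intShift`, `torusDist`);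
  oriented line segments `𝒳 = 𝕋² × B_{1/4}` (`Seg`); joinable segments and ADDITIVE functions
  (Def. 3.1: `Seg.Joinable`, `IsAdditive`, `Omega`); the metric `d` and "far" pairs, the semimetric
  `ρ` (Def. 3.3: `segDist`, `Far`, `hullArea`, `rho`); the extended norm `|A|_α` (3.3) (`alphaNorm`)
  and `Ω_α` (`OmegaAlpha`); the growth norm `|A|_{α-gr}` (Def. 3.7: `grNorm`, `OmegaGr`); vees and
  `|A|_{α-vee}` (Def. 3.8: `IsVee`, `veeNorm`).
* §3.3: the line-integral map `ι : ΩC → Ω` (3.17) (`lineIntegral`), smooth / continuous / Hölder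
  periodic `1`-forms (`OneForm.*`), and `Ω¹_α`, `Ω¹_{α-gr}` = closure of `ι(ΩC^∞)` (Def. 3.22:
  `Omega1`, `Omega1Gr`).
* §3.4: gauge transformations `𝔊^α = C^α(𝕋², G)`, the little Hölder group `𝔊^{0,α}` (closure of
  smooth maps), the `C^α` distance (`GaugeGroup`, `LittleGaugeGroup`, `gaugeHolder`, `gaugeDist`),
  the gauge action `A^g` of Def. 3.26 (`gaugeActSum`, `gaugeAct`) and gauge equivalence `A ∼ Ā`
  (`GaugeEquiv`).
* §3.5: holonomy along a segment (3.25) and along piecewise affine paths / loops (`holApprox`,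
  `hol`, `IsChain`, `holChain`, `IsLoopAt`); along `C^{1,β}` curves (`IsC1HolderCurve`,
  `chordSeg`, `pathHolApprox`, `pathHol`).
* §3.6: orbits `[A]` under `𝔊^{0,α}` (Def. 3.37: `orbit`), the metric `k_α` built from `K`
  (Def. 3.41: `bigK`, `chainCost`, `kMetric`) and the Hausdorff distance `D_α` on orbits
  (Def. 3.44: `orbitEDist`).
* Named facts (unproved `Prop`s, exact hypotheses): `normEquivalence_vee` (Thm 3.11, vee case),
  `holderForms_embed` (Rem. 3.23 = Thm 2.1 (ii), first embedding), `omega1Gr_vanishing` (Prop. 3.25),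
  `gaugeAction_omega1` (Thm 3.27 + Cor. 3.36 = Thm 2.1 (iii), action part),
  `gaugeEquiv_iff_holonomy` (Prop. 3.35), `orbit_iff_holonomy` (Thm 2.1 (iv) with Prop. 3.39),
  `orbits_closed` (Lemma 3.40), `orbitSpace_polish` (Thm 3.45 = Thm 2.1 (iii), metric part),
  `holonomy_holderContinuous` (Thm 2.1 (i)), and the conjunction `stateSpace2D` (Thm 2.1).

## Renderings (recorded for the reviewer)

* (R1) `𝕋²`-objects are `ℤ²`-periodic objects on the cover `ℝ² = EuclideanSpace ℝ (Fin 2)`; the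
  geodesic distance is `torusDist x y = inf_n ‖x − y − n‖`; segments have length `≤ 1/4 < 1/2`, so a
  segment of `𝕋²` is a pair `(x, v)` of the cover up to `x ↦ x + n`, and additive functions are
  required to be periodic (`IsPeriodic`). Joinability / vees / chains are relations between
  representatives (exact equality of endpoints in the cover); since all functions are periodic this
  types exactly the printed torus notions. The area `Area(ℓ, ℓ̄)` of the convex hull of the four
  endpoints (print: "well-defined whenever `ℓ, ℓ̄` are not far") is the infimum over lattice
  translates of `ℓ̄` of the Lebesgue area of the planar convex hull (`hullArea`); for not-far pairs
  (all four points within torus distance `< 1/2`) this is the printed local picture.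
* (R2) Print takes `E`-valued functions for a Banach space `E`, then `E = 𝔤 ⊂ 𝔲(N)` (§3.4: "we can
  assume … `G` is a Lie subgroup of unitary matrices"). Here, instance-free as elsewhere in this
  directory: values are complex `N × N` matrices measured by the tree's `frobNorm`; the structure
  group enters through the tree's `LatticeRep G` (faithful continuous unitary `ρ : G →* M_N(ℂ)`),
  `𝔤 = LatticeRep.lieAlg r`, and `V`-valued objects for a real subspace `V ≤ M_N(ℂ)` (`V = 𝔤` in
  the facts). `Ω¹_α(𝕋², 𝔤)` is typed as the closure of `ι` of smooth `𝔤`-valued forms.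
* (R3) Extended (semi)norms take values in `ℝ≥0∞` (print: "(extended) norm"); `Ω_α = {|A|_α < ∞}`.
* (R4) Young integrals and Young ODEs (print: Def. 3.26 "both terms make sense as `𝔤`-valued Young
  integrals since `α + β > 1`"; (3.25) "admits a unique solution … as a Young integral") are typed
  as limits (`limUnder atTop`, junk if divergent) along the UNIFORM partitions `{k/(n+1)}` of the
  left-point Riemann–Stieltjes sums, resp. of the ordered products of exponentials of the increments
  (product integral / exponential Euler scheme); whenever the printed Young object exists these
  limits exist and agree with it, and the facts below assert the existence of the limits in the
  printed regimes as part of their statements. Holonomy along a `C^{1,β}` curve `γ` (Thm 2.1 (i),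
  via Def. 3.15 / Thm 3.18) is the limit of the holonomies of the piecewise affine interpolations
  `γ^{D_n}` along uniform partitions (`pathHol`).
* (R5) Def. 3.41: the held text layer garbles the display defining `K`; it is read as
  `K(A,B) = |‖A‖ − ‖B‖| + (‖A − B‖ ∧ 1)/((‖A‖ ∧ ‖B‖) + 1)`, the reading consistent with the three
  printed consequences (3.34)–(3.36) and the proof of Lemma 3.42.
* (R6) Curves in §3.2 / Thm 2.1 (i) have diameter `≤ 1/4` (print, §3.2: "we assume throughout this
  subsection that all functions `γ` … have diameter at most `1/4`"); longer curves are handled in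
  print by concatenation and are not transcribed (`-- TODO(general form)` at `pathHol`).

## Not transcribed

The triangle / symmetric-difference norms `|·|_{α-tri}`, `|·|_{α-sym}` of Def. 3.10 and the
`n`-gons of Def. 3.9 (Thm 3.11 is typed in its vee case only); §3.2 (Defs 3.15–3.16, Lemma 3.17,
Thm 3.18, Cor. 3.19, Props 3.20–3.21) except through Thm 2.1 (i); the projection
`π : Ω_{α-gr} → ΩC^{α−1}` and the second embedding `Ω¹_α ↪ ΩC^{0,α−1}` of Thm 2.1 (ii) / Rem. 3.23
(negative Hölder–Besov spaces are not in the tree's vocabulary here); Prop. 3.28 and Lemmas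
3.29–3.33, 3.38, 3.42–3.43, 3.46–3.48 (proof steps). The SPDE (§§2, 4–7) is typed in the sibling
file `Langevin2D.lean`; the 3D theory in `YMH3D.lean`.
-/

noncomputable section

open MeasureTheory Filter Topology
open scoped ENNReal

namespace Literature.MathematicalPhysics.QuantumFieldTheory.CCHS2024

/-! ### The torus `𝕋² = ℝ²/ℤ²` through its universal cover -/

/-- The universal cover `ℝ²` of the torus `𝕋² = ℝ²/ℤ²` (print identifies `𝕋²` with `[-½,½)²`
with the geodesic distance). [cite: ChandraChevyrevHairerShen2022YM2, §1.5 (Notation and conventions)] -/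
abbrev E2 : Type := EuclideanSpace ℝ (Fin 2)

/-- The lattice vector `n ∈ ℤ² ⊂ ℝ²`. [folklore] -/
def intShift (n : Fin 2 → ℤ) : E2 := (EuclideanSpace.equiv (Fin 2) ℝ).symm fun i => (n i : ℝ)

/-- Geodesic distance on `𝕋²` between the classes of `x, y ∈ ℝ²`: `|x − y| = inf_{n ∈ ℤ²} ‖x − y − n‖`
(print's `|x − y|`, "by an abuse of notation"). [cite: ChandraChevyrevHairerShen2022YM2, §1.5 (Notation and conventions)] -/
def torusDist (x y : E2) : ℝ := ⨅ n : Fin 2 → ℤ, ‖x - y - intShift n‖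

/-! ### §3.1 Oriented line segments and additive functions -/

/-- The set `𝒳 = 𝕋² × B_{1/4}` of oriented line segments of length at most `1/4`: pairs
`ℓ = (x, v)` (initial point, direction) with `|v| ≤ 1/4`, the initial point taken in the cover (R1).
[cite: ChandraChevyrevHairerShen2022YM2, §3.1 (first display: 𝒳 ≔ 𝕋² × B_{1/4})] -/
abbrev Seg : Type := {p : E2 × E2 // ‖p.2‖ ≤ (1 : ℝ) / 4}

namespace Seg

/-- Initial point `ℓ_i = x` of `ℓ = (x, v)`. [cite: ChandraChevyrevHairerShen2022YM2, §3.1 (ℓ_i ≔ x, ℓ_f ≔ x + v)] -/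
def ini (ℓ : Seg) : E2 := ℓ.1.1

/-- Direction `v` of `ℓ = (x, v)`. [cite: ChandraChevyrevHairerShen2022YM2, §3.1 (𝒳 ≔ 𝕋² × B_{1/4})] -/
def dir (ℓ : Seg) : E2 := ℓ.1.2

/-- Final point `ℓ_f = x + v`. [cite: ChandraChevyrevHairerShen2022YM2, §3.1 (ℓ_i ≔ x, ℓ_f ≔ x + v)] -/
def fin (ℓ : Seg) : E2 := ℓ.1.1 + ℓ.1.2

/-- Length `|ℓ| = |v|`. [cite: ChandraChevyrevHairerShen2022YM2, §3.1 (|ℓ| ≔ |v|)] -/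
def len (ℓ : Seg) : ℝ := ‖ℓ.1.2‖

/-- The same segment of `𝕋²` with initial point translated by `n ∈ ℤ²` in the cover (R1). [folklore] -/
def shift (n : Fin 2 → ℤ) (ℓ : Seg) : Seg := ⟨(ℓ.ini + intShift n, ℓ.dir), ℓ.2⟩

/-- The degenerate segment `(x, 0)` at `x`. [folklore] -/
def degenerate (x : E2) : Seg := ⟨(x, 0), norm_zero.trans_le (div_nonneg zero_le_one zero_lt_four.le)⟩

/-- The `k`-th point `x + (k/(n+1)) v` of the uniform partition of `ℓ = (x, v)` into `n + 1` pieces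
(R4). [folklore] -/
def pt (ℓ : Seg) (n k : ℕ) : E2 := ℓ.ini + ((k : ℝ) * ((n + 1 : ℕ) : ℝ)⁻¹) • ℓ.dir

/-- The `k`-th piece `ℓ^{k/(n+1),(k+1)/(n+1)} = (x + (k/(n+1)) v, v/(n+1))` of the uniform partition of
`ℓ` into `n + 1` sub-segments (print's `ℓ^{s,t}`, proof of Lemma 3.14) (R4).
[cite: ChandraChevyrevHairerShen2022YM2, §3.1 (proof of Lemma 3.14: the sub-segment ℓ^{s,t})] -/
def piece (ℓ : Seg) (n k : ℕ) : Seg :=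
  ⟨(ℓ.pt n k, ((n + 1 : ℕ) : ℝ)⁻¹ • ℓ.dir),
    ((norm_smul _ _).trans_le
      (mul_le_of_le_one_left (norm_nonneg _)
        ((Real.norm_of_nonneg (inv_nonneg.2 (Nat.cast_nonneg _))).trans_le
          (Nat.cast_inv_le_one _)))).trans ℓ.2⟩

/-- `ℓ = (x, v)` and `ℓ̄ = (x̄, v̄)` are **joinable**: `x̄ = x + v`, the directions are collinear
(`v = c w`, `v̄ = c̄ w` for a unit vector `w`; `c, c̄ ∈ [-¼, ¼]` is automatic) and `|c + c̄| ≤ ¼`,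
i.e. `|v + v̄| ≤ ¼`; then `ℓ ⊔ ℓ̄ = (x, (c + c̄) w) = (x, v + v̄)`. [cite: ChandraChevyrevHairerShen2022YM2, Def. 3.1] -/
def Joinable (ℓ ℓ' : Seg) : Prop :=
  ℓ'.ini = ℓ.fin ∧ (∃ w : E2, ‖w‖ = 1 ∧ ∃ c c' : ℝ, ℓ.dir = c • w ∧ ℓ'.dir = c' • w) ∧
    ‖ℓ.dir + ℓ'.dir‖ ≤ (1 : ℝ) / 4

/-- The concatenation `ℓ ⊔ ℓ̄ = (x, v + v̄)` of two segments (meaningful for joinable pairs).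
[cite: ChandraChevyrevHairerShen2022YM2, Def. 3.1] -/
def join (ℓ ℓ' : Seg) (h : ‖ℓ.dir + ℓ'.dir‖ ≤ (1 : ℝ) / 4) : Seg := ⟨(ℓ.ini, ℓ.dir + ℓ'.dir), h⟩

end Seg

/-- `E`-valued functions on line segments, `E = M_N(ℂ)` (R2); print's `Ω` is the subset `Omega` of
additive measurable ones. [cite: ChandraChevyrevHairerShen2022YM2, Def. 3.1] -/
abbrev LineFn (N : ℕ) : Type := Seg → Matrix (Fin N) (Fin N) ℂ

section LineFunctions

variable {N : ℕ}

/-- `A` is **additive**: `A(ℓ ⊔ ℓ̄) = A(ℓ) + A(ℓ̄)` for all joinable `ℓ, ℓ̄`. (It follows that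
`A(x, 0) = 0`.) [cite: ChandraChevyrevHairerShen2022YM2, Def. 3.1] -/
def IsAdditive (A : LineFn N) : Prop :=
  ∀ (ℓ ℓ' : Seg) (h : ℓ.Joinable ℓ'), A (ℓ.join ℓ' h.2.2) = A ℓ + A ℓ'

/-- `A` is a function of segments OF THE TORUS `𝒳 = 𝕋² × B_{1/4}`: invariant under `x ↦ x + n`,
`n ∈ ℤ²` (R1). [cite: ChandraChevyrevHairerShen2022YM2, §3.1 (𝒳 ≔ 𝕋² × B_{1/4}) and §1.5 (𝕋² = [-½,½)²)] -/
def IsPeriodic (A : LineFn N) : Prop := ∀ (n : Fin 2 → ℤ) (ℓ : Seg), A (ℓ.shift n) = A ℓ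

/-- `A` takes values in the real subspace `V ≤ M_N(ℂ)` — print's `E`-valued functions with
`E = 𝔤 ⊂ 𝔲(N)` (R2). [cite: ChandraChevyrevHairerShen2022YM2, Def. 3.1 (E-valued) and §3.4 ("we … take E = 𝔤")] -/
def LineFn.ValuedIn (V : Submodule ℝ (Matrix (Fin N) (Fin N) ℂ)) (A : LineFn N) : Prop := ∀ ℓ, A ℓ ∈ V

/-- Print's `Ω = Ω(𝕋², E)`: all measurable `E`-valued additive functions on `𝒳` (periodic, R1;
measurability entrywise, R2). [cite: ChandraChevyrevHairerShen2022YM2, Def. 3.1] -/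
def Omega (N : ℕ) : Set (LineFn N) :=
  {A | IsAdditive A ∧ IsPeriodic A ∧ ∀ a b : Fin N, Measurable fun ℓ : Seg => A ℓ a b}

/-- The metric `d(ℓ, ℓ̄) = |ℓ_i − ℓ̄_i| ∨ |ℓ_f − ℓ̄_f|` on `𝒳` (torus distances of the endpoints).
[cite: ChandraChevyrevHairerShen2022YM2, §3.1 (display defining d(ℓ, ℓ̄), before Def. 3.3)] -/
def segDist (ℓ ℓ' : Seg) : ℝ := max (torusDist ℓ.ini ℓ'.ini) (torusDist ℓ.fin ℓ'.fin)

/-- `ℓ, ℓ̄` are **far** if `d(ℓ, ℓ̄) > ¼ (|ℓ| ∧ |ℓ̄|)`. [cite: ChandraChevyrevHairerShen2022YM2, Def. 3.3] -/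
def Far (ℓ ℓ' : Seg) : Prop := (1 / 4 : ℝ) * min ℓ.len ℓ'.len < segDist ℓ ℓ'

/-- `Area(ℓ, ℓ̄)`: the area of the convex hull of the four endpoints `ℓ_i, ℓ_f, ℓ̄_f, ℓ̄_i`, computed in
the cover as the infimum over lattice translates of `ℓ̄` (R1; print: "well-defined whenever `ℓ, ℓ̄`
are not far"). [cite: ChandraChevyrevHairerShen2022YM2, Def. 3.3] -/
def hullArea (ℓ ℓ' : Seg) : ℝ :=
  ⨅ n : Fin 2 → ℤ,
    (volume (convexHull ℝ
      ({ℓ.ini, ℓ.fin, ℓ'.ini + intShift n, ℓ'.fin + intShift n} : Set E2))).toReal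

/-- The semimetric `ρ(ℓ, ℓ̄) = |ℓ| + |ℓ̄|` if `ℓ, ℓ̄` are far, and
`|ℓ_i − ℓ̄_i| + |ℓ_f − ℓ̄_f| + Area(ℓ, ℓ̄)^{1/2}` otherwise (classical case distinction).
[cite: ChandraChevyrevHairerShen2022YM2, Def. 3.3] -/
def rho (ℓ ℓ' : Seg) : ℝ :=
  @ite ℝ (Far ℓ ℓ') (Classical.dec _) (ℓ.len + ℓ'.len)
    (torusDist ℓ.ini ℓ'.ini + torusDist ℓ.fin ℓ'.fin + Real.sqrt (hullArea ℓ ℓ'))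

/-- The extended norm `|A|_α = sup_{ρ(ℓ,ℓ̄) > 0} |A(ℓ) − A(ℓ̄)| / ρ(ℓ, ℓ̄)^α` on `Ω`, `α ∈ [0,1]`
(values in `[0, ∞]`, R3; sizes of matrices by `frobNorm`, R2). [cite: ChandraChevyrevHairerShen2022YM2, §3.1 eq. (3.3)] -/
def alphaNorm (α : ℝ) (A : LineFn N) : ℝ≥0∞ :=
  ⨆ (ℓ : Seg) (ℓ' : Seg) (_ : 0 < rho ℓ ℓ'), ENNReal.ofReal (frobNorm (A ℓ - A ℓ') / rho ℓ ℓ' ^ α)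

/-- The Banach space `Ω_α = {A ∈ Ω : |A|_α < ∞}`. [cite: ChandraChevyrevHairerShen2022YM2, §3.1 (after eq. (3.3))] -/
def OmegaAlpha (N : ℕ) (α : ℝ) : Set (LineFn N) := {A | A ∈ Omega N ∧ alphaNorm α A < ∞}

/-- The growth norm `|A|_{α-gr} = sup_{|ℓ| > 0} |A(ℓ)| / |ℓ|^α`. [cite: ChandraChevyrevHairerShen2022YM2, Def. 3.7] -/
def grNorm (α : ℝ) (A : LineFn N) : ℝ≥0∞ :=
  ⨆ (ℓ : Seg) (_ : 0 < ℓ.len), ENNReal.ofReal (frobNorm (A ℓ) / ℓ.len ^ α)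

/-- The Banach space `Ω_{α-gr} = {A ∈ Ω : |A|_{α-gr} < ∞}`. [cite: ChandraChevyrevHairerShen2022YM2, Def. 3.7] -/
def OmegaGr (N : ℕ) (α : ℝ) : Set (LineFn N) := {A | A ∈ Omega N ∧ grNorm α A < ∞}

/-- `ℓ, ℓ̄` form a **vee**: not far, same length, same initial point. [cite: ChandraChevyrevHairerShen2022YM2, Def. 3.8] -/
def IsVee (ℓ ℓ' : Seg) : Prop := ¬ Far ℓ ℓ' ∧ ℓ.len = ℓ'.len ∧ ℓ.ini = ℓ'.ini

/-- The extended seminorm `|A|_{α-vee} = sup |A(ℓ) − A(ℓ̄)| / Area(ℓ, ℓ̄)^{α/2}` over distinct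
`ℓ, ℓ̄` forming a vee. [cite: ChandraChevyrevHairerShen2022YM2, Def. 3.8] -/
def veeNorm (α : ℝ) (A : LineFn N) : ℝ≥0∞ :=
  ⨆ (ℓ : Seg) (ℓ' : Seg) (_ : IsVee ℓ ℓ') (_ : ℓ ≠ ℓ'),
    ENNReal.ofReal (frobNorm (A ℓ - A ℓ') / hullArea ℓ ℓ' ^ (α / 2))

/-- **Theorem 3.11 (vee case).** There is `C ≥ 1` with
`C⁻¹ |A|_α ≤ |A|_{α-gr} + |A|_{α-vee} ≤ C |A|_α` for all `α ∈ [0,1]` and `A ∈ Ω`. (Print states the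
same with `|·|_{α-tri}` or `|·|_{α-sym}` in place of `|·|_{α-vee}`; those norms are not transcribed.)
[cite: ChandraChevyrevHairerShen2022YM2, Thm 3.11] -/
def normEquivalence_vee : Prop :=
  ∀ N : ℕ, ∃ C : ℝ, 1 ≤ C ∧ ∀ α : ℝ, 0 ≤ α → α ≤ 1 → ∀ A ∈ Omega N,
    alphaNorm α A ≤ ENNReal.ofReal C * (grNorm α A + veeNorm α A) ∧
      grNorm α A + veeNorm α A ≤ ENNReal.ofReal C * alphaNorm α A

/-! ### §3.3 Continuous `1`-forms, the line integral `ι`, and the closures `Ω¹_α`, `Ω¹_{α-gr}` -/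

/-- A (matrix-valued) `1`-form `A = A₁ dx₁ + A₂ dx₂` on the cover, given by its two components (R1, R2).
[cite: ChandraChevyrevHairerShen2022YM2, §1.5 (ΩB: E-valued 1-forms A = ∑ A_i dx_i)] -/
abbrev OneForm (N : ℕ) : Type := Fin 2 → E2 → Matrix (Fin N) (Fin N) ℂ

namespace OneForm

/-- The `1`-form lives on `𝕋²`: each component is `ℤ²`-periodic (R1).
[cite: ChandraChevyrevHairerShen2022YM2, §1.5 (ΩB for B a space of E-valued functions on 𝕋²)] -/
def IsPeriodic (B : OneForm N) : Prop := ∀ (i : Fin 2) (n : Fin 2 → ℤ) (x : E2), B i (x + intShift n) = B i x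

/-- Continuity of the components (`B ∈ ΩC`). [cite: ChandraChevyrevHairerShen2022YM2, §3.3 (ΩC, the Banach space of continuous E-valued 1-forms)] -/
def IsContinuous (B : OneForm N) : Prop := ∀ i : Fin 2, Continuous (B i)

/-- Smoothness of the components (`B ∈ ΩC^∞`), entrywise (R2). [cite: ChandraChevyrevHairerShen2022YM2, Def. 3.22 (ι(ΩC^∞))] -/
def IsSmooth (B : OneForm N) : Prop :=
  ∀ (i : Fin 2) (a b : Fin N), ContDiff ℝ (⊤ : ℕ∞) fun x : E2 => B i x a b

/-- The components take values in the real subspace `V ≤ M_N(ℂ)` (`V = 𝔤`: `𝔤`-valued `1`-forms) (R2).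
[cite: ChandraChevyrevHairerShen2022YM2, §1 (connections identified with 𝔤-valued 1-forms on 𝕋^d) and §3.4 (E = 𝔤)] -/
def ValuedIn (V : Submodule ℝ (Matrix (Fin N) (Fin N) ℂ)) (B : OneForm N) : Prop := ∀ i x, B i x ∈ V

/-- The sup norm `|B|_∞ = ∑_i |B_i|_∞` of a `1`-form (extended, R3; print sums the component norms,
here the supremum of the component sizes — equivalent up to the factor `2`). [cite: ChandraChevyrevHairerShen2022YM2, §1.5 (|A|_{ΩB} ≔ ∑ |A_i|_B)] -/
def supNorm (B : OneForm N) : ℝ≥0∞ := ⨆ (i : Fin 2) (x : E2), ENNReal.ofReal (frobNorm (B i x))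

/-- The Hölder seminorm `|B|_{β-Höl} = sup_{x ≠ y} |B(x) − B(y)| / |x − y|^β` (torus distance) of the
components of a `1`-form. [cite: ChandraChevyrevHairerShen2022YM2, §1.5 (the seminorm |f|_{α-Höl})] -/
def holderSemi (β : ℝ) (B : OneForm N) : ℝ≥0∞ :=
  ⨆ (i : Fin 2) (x : E2) (y : E2) (_ : 0 < torusDist x y),
    ENNReal.ofReal (frobNorm (B i x - B i y) / torusDist x y ^ β)

end OneForm

/-- Smooth `V`-valued `1`-forms on `𝕋²` (print's `ΩC^∞` with `E = V`). [cite: ChandraChevyrevHairerShen2022YM2, Def. 3.22] -/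
def smoothForms (V : Submodule ℝ (Matrix (Fin N) (Fin N) ℂ)) : Set (OneForm N) :=
  {B | B.IsPeriodic ∧ B.IsSmooth ∧ B.ValuedIn V}

/-- The canonical injection `ι : ΩC → Ω_{1-gr}`,
`(ιA)(x, v) = ∫₀¹ ∑_i A_i(x + t v) v_i dt` (entrywise complex integrals, R2).
[cite: ChandraChevyrevHairerShen2022YM2, §3.3 eq. (3.17) and Rem. 3.2] -/
def lineIntegral (B : OneForm N) : LineFn N := fun ℓ =>
  Matrix.of fun a b => ∫ t in (0 : ℝ)..1, ∑ i : Fin 2, B i (ℓ.ini + t • ℓ.dir) a b * ((ℓ.dir i : ℝ) : ℂ)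

/-- **`Ω¹_α`** (with values in `V`): the closure of `ι(ΩC^∞)` in `Ω_α` — elements of `Ω_α`
approximable in `|·|_α` by line integrals of smooth `V`-valued `1`-forms. For `α ∈ (2/3, 1)` and
`V = 𝔤` this is the Banach space of Thm 2.1. [cite: ChandraChevyrevHairerShen2022YM2, Def. 3.22] -/
def Omega1 (V : Submodule ℝ (Matrix (Fin N) (Fin N) ℂ)) (α : ℝ) : Set (LineFn N) :=
  {A | A ∈ OmegaAlpha N α ∧
    ∀ ε : ℝ, 0 < ε → ∃ B ∈ smoothForms V, alphaNorm α (A - lineIntegral B) < ENNReal.ofReal ε}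

/-- **`Ω¹_{α-gr}`**: the closure of `ι(ΩC^∞)` in `Ω_{α-gr}`. [cite: ChandraChevyrevHairerShen2022YM2, Def. 3.22] -/
def Omega1Gr (V : Submodule ℝ (Matrix (Fin N) (Fin N) ℂ)) (α : ℝ) : Set (LineFn N) :=
  {A | A ∈ OmegaGr N α ∧
    ∀ ε : ℝ, 0 < ε → ∃ B ∈ smoothForms V, grNorm α (A - lineIntegral B) < ENNReal.ofReal ε}

/-- **Remark 3.23 / Theorem 2.1 (ii), first embedding `ΩC^{α/2} ↪ Ω_α`, `ΩC^{0,α/2} ↪ Ω¹_α`.**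
For `α ∈ [0,1]`: `ι` maps `α/2`-Hölder continuous `1`-forms boundedly into `Ω_α`
(`|ιB|_α ≤ C (|B|_∞ + |B|_{α/2-Höl})`), and maps the little Hölder space `ΩC^{0,α/2}` (closure of
smooth forms in `C^{α/2}`) into `Ω¹_α`. (Print adds that the exponent `α/2` is sharp; the second
embedding `Ω¹_α ↪ ΩC^{0,α−1}` is not transcribed.) [cite: ChandraChevyrevHairerShen2022YM2, Rem. 3.23 and Thm 2.1 (ii)] -/
def holderForms_embed : Prop :=
  ∀ (N : ℕ) (V : Submodule ℝ (Matrix (Fin N) (Fin N) ℂ)) (α : ℝ), 0 ≤ α → α ≤ 1 →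
    (∃ C : ℝ, 0 ≤ C ∧ ∀ B : OneForm N, B.IsPeriodic → B.IsContinuous →
        alphaNorm α (lineIntegral B) ≤
          ENNReal.ofReal C * (B.supNorm + B.holderSemi (α / 2))) ∧
    (∀ B : OneForm N, B.IsPeriodic → B.IsContinuous → B.ValuedIn V →
      B.supNorm + B.holderSemi (α / 2) < ∞ →
      (∀ ε : ℝ, 0 < ε → ∃ B' ∈ smoothForms V,
          (B - B').supNorm + (B - B').holderSemi (α / 2) < ENNReal.ofReal ε) →
        lineIntegral B ∈ Omega1 V α)

/-- **Proposition 3.25.** For `α ∈ (0,1)` and `A ∈ Ω¹_{α-gr}`: `A` is continuous on `𝒳` and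
`lim_{ε → 0} sup_{|ℓ| < ε} |A(ℓ)| / |ℓ|^α = 0`. [cite: ChandraChevyrevHairerShen2022YM2, Prop. 3.25] -/
def omega1Gr_vanishing : Prop :=
  ∀ (N : ℕ) (V : Submodule ℝ (Matrix (Fin N) (Fin N) ℂ)) (α : ℝ), 0 < α → α < 1 →
    ∀ A ∈ Omega1Gr V α,
      Continuous A ∧
        ∀ δ : ℝ, 0 < δ → ∃ ε : ℝ, 0 < ε ∧ ∀ ℓ : Seg, 0 < ℓ.len → ℓ.len < ε →
          frobNorm (A ℓ) ≤ δ * ℓ.len ^ α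

end LineFunctions

/-! ### §3.4 Gauge transformations -/

section Gauge

variable {G : Type*} [Group G] [TopologicalSpace G] (r : LatticeRep G)

/-- A map `g : 𝕋² → G` (an element of `𝔊^α = C^α(𝕋², G)` once Hölder), as a `ℤ²`-periodic map on
the cover (R1). [cite: ChandraChevyrevHairerShen2022YM2, §3.4 (𝔊^α ≔ C^α(𝕋², G))] -/
def IsPeriodicGauge (g : E2 → G) : Prop := ∀ (n : Fin 2 → ℤ) (x : E2), g (x + intShift n) = g x

/-- The Hölder seminorm `|g|_{α-Höl} = sup_{x ≠ y} |g(x) − g(y)| / |x − y|^α` of `g : 𝕋² → G ⊂ M_N(ℂ)`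
(`G` embedded by the faithful unitary representation `ρ = r.ρ`, sizes by `frobNorm`; print: "different
choices of unitary representation yield equivalent distances"). [cite: ChandraChevyrevHairerShen2022YM2, §3.4 (|g − h| and |g|_{α-Höl} for g ∈ 𝔊^α)] -/
def gaugeHolder (α : ℝ) (g : E2 → G) : ℝ≥0∞ :=
  ⨆ (x : E2) (y : E2) (_ : 0 < torusDist x y),
    ENNReal.ofReal (frobNorm (r.ρ (g x) - r.ρ (g y)) / torusDist x y ^ α)

/-- The gauge group `𝔊^α = C^α(𝕋², G)` (a topological group): periodic maps with finite `α`-Hölder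
seminorm (`|g|_∞` is automatically bounded, `ρ(G)` being unitary). [cite: ChandraChevyrevHairerShen2022YM2, §3.4 (𝔊^α ≔ C^α(𝕋², G))] -/
def GaugeGroup (α : ℝ) : Set (E2 → G) := {g | IsPeriodicGauge g ∧ gaugeHolder r α g < ∞}

/-- The `C^α` distance `|g − h|_{C^α} = |g − h|_∞ + |g − h|_{α-Höl}` between gauge transformations,
computed in the ambient matrix space `F ⊇ G` (print: "we implicitly identify them in `F`").
[cite: ChandraChevyrevHairerShen2022YM2, §3.4 (expressions |g − h| with g, h ∈ G identified in F) and §1.5 (|f|_{C^α} ≔ |f|_∞ + |f|_{α-Höl})] -/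
def gaugeDist (α : ℝ) (g h : E2 → G) : ℝ≥0∞ :=
  (⨆ x : E2, ENNReal.ofReal (frobNorm (r.ρ (g x) - r.ρ (h x)))) +
    ⨆ (x : E2) (y : E2) (_ : 0 < torusDist x y),
      ENNReal.ofReal
        (frobNorm ((r.ρ (g x) - r.ρ (h x)) - (r.ρ (g y) - r.ρ (h y))) / torusDist x y ^ α)

/-- `g : 𝕋² → G` is smooth (`g ∈ 𝔊^∞ = C^∞(𝕋², G)`): the matrix entries of `ρ ∘ g` are `C^∞` (R2).
[cite: ChandraChevyrevHairerShen2022YM2, §1 (𝔊^∞ = C^∞(𝕋^d, G))] -/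
def IsSmoothGauge (g : E2 → G) : Prop := ∀ a b : Fin r.N, ContDiff ℝ (⊤ : ℕ∞) fun x : E2 => r.ρ (g x) a b

/-- The little Hölder gauge group `𝔊^{0,α}`: the closure of `C^∞(𝕋², G)` in `𝔊^α`
(for `α < 1` equivalently `lim_{ε→0} sup_{|x−y|<ε} |g(x) − g(y)|/|x − y|^α = 0`, Lemma 3.38).
[cite: ChandraChevyrevHairerShen2022YM2, §3.6 (𝔊^{0,α} ≔ closure of C^∞(𝕋², G) in 𝔊^α) and Thm 2.1 (iii)] -/
def LittleGaugeGroup (α : ℝ) : Set (E2 → G) :=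
  {g | g ∈ GaugeGroup r α ∧
    ∀ ε : ℝ, 0 < ε → ∃ h ∈ GaugeGroup r α, IsSmoothGauge r h ∧ gaugeDist r α g h < ENNReal.ofReal ε}

/-- The left-point Riemann–Stieltjes sum over the uniform partition of `ℓ = (x, v)` into `n + 1`
pieces of the two Young integrals defining `A^g(ℓ)`:
`∑_k ( Ad_{g(x_k)} A(ℓ_k) − [g(x_{k+1}) − g(x_k)] g(x_k)⁻¹ )`, `x_k = x + (k/(n+1)) v`,
`ℓ_k = (x_k, v/(n+1))`, `Ad_g X = g X g⁻¹ = g X g^*` (`ρ(G)` unitary) (R4).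
[cite: ChandraChevyrevHairerShen2022YM2, Def. 3.26 (A^g(ℓ) ≔ ∫₀¹ (Ad_{g(x+tv)} dℓ_A(t) − [dg(x+tv)] g⁻¹(x+tv)))] -/
def gaugeActSum (g : E2 → G) (A : LineFn r.N) (ℓ : Seg) (n : ℕ) : Matrix (Fin r.N) (Fin r.N) ℂ :=
  ∑ k ∈ Finset.range (n + 1),
    (r.ρ (g (ℓ.pt n k)) * A (ℓ.piece n k) * star (r.ρ (g (ℓ.pt n k))) -
      (r.ρ (g (ℓ.pt n (k + 1))) - r.ρ (g (ℓ.pt n k))) * star (r.ρ (g (ℓ.pt n k))))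

/-- **The gauge action `A ↦ A^g`** on additive functions (Def. 3.26), the limit of the Young–Riemann
sums `gaugeActSum` along the uniform partitions (R4; junk where the limit does not exist — by
print it exists for `A ∈ Ω_{α-gr}`, `g ∈ 𝔊^β`, `α + β > 1`, `β > ½`). For continuous `A` and `C¹` `g`
this is `A^g = Ad_g A − (dg) g⁻¹` ((3.23)). Print: for `α ≤ β` a left action, `(A^h)^g = A^{gh}`.
[cite: ChandraChevyrevHairerShen2022YM2, Def. 3.26 and eq. (3.23)] -/
def gaugeAct (g : E2 → G) (A : LineFn r.N) : LineFn r.N := fun ℓ =>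
  limUnder atTop fun n : ℕ => gaugeActSum r g A ℓ n

/-- Gauge equivalence `A ∼ Ā` on `Ω_{α-gr}`, `α > ½`: `Ā = A^g` for some `g ∈ 𝔊^α`.
[cite: ChandraChevyrevHairerShen2022YM2, Def. 3.26 (A ∼ Ā)] -/
def GaugeEquiv (α : ℝ) (A A' : LineFn r.N) : Prop := ∃ g ∈ GaugeGroup r α, gaugeAct r g A = A'

/-! ### §3.5 Holonomies -/

/-- The ordered product `∏_{k=0}^{n} exp(A(ℓ_k))` over the uniform partition of `ℓ` into `n + 1`
pieces — the exponential Euler scheme for the Young ODE `dy = y dℓ_A`, `y(0) = 1` (R4).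
[cite: ChandraChevyrevHairerShen2022YM2, §3.5 eq. (3.25)] -/
def holApprox (A : LineFn r.N) (ℓ : Seg) (n : ℕ) : Matrix (Fin r.N) (Fin r.N) ℂ :=
  ((List.range (n + 1)).map fun k => NormedSpace.exp (A (ℓ.piece n k))).prod

/-- **The holonomy `hol(A, ℓ) = y(1)`** of `A` along the segment `ℓ`, `y` the solution of the Young
ODE `dy(t) = y(t) dℓ_A(t)`, `y(0) = 1` (3.25) (unique for `A ∈ Ω_{α-gr}`, `α > ½`), typed as the
limit of `holApprox` (R4). [cite: ChandraChevyrevHairerShen2022YM2, §3.5 eq. (3.25) (hol(A, ℓ) ≔ y(1))] -/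
def hol (A : LineFn r.N) (ℓ : Seg) : Matrix (Fin r.N) (Fin r.N) ℂ := limUnder atTop (holApprox r A ℓ)

/-- A list of segments is a **chain** (a piecewise affine path): each segment starts where the
previous one ends (in the cover, R1). [cite: ChandraChevyrevHairerShen2022YM2, §3.2 (piecewise affine γ: γ^D, ℓ_i) and §3.5 (𝓛_{xy})] -/
def IsChain : List Seg → Prop
  | [] => True
  | [_] => True
  | ℓ :: ℓ' :: L => ℓ'.ini = ℓ.fin ∧ IsChain (ℓ' :: L)

/-- Holonomy along a piecewise affine path: the ordered product of the segment holonomies.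
[cite: ChandraChevyrevHairerShen2022YM2, §3.5 ("we extend the definition hol(A, γ) to any piecewise affine path … ordered product")] -/
def holChain (A : LineFn r.N) (L : List Seg) : Matrix (Fin r.N) (Fin r.N) ℂ := (L.map (hol r A)).prod

/-- `L ∈ 𝓛_{xx}`: a piecewise affine LOOP of `𝕋²` based at (the class of) `x` — a non-empty chain from
`x` to a lattice translate `x + n` (R1: loops of `𝕋²`, contractible or not, lift to such chains).
[cite: ChandraChevyrevHairerShen2022YM2, §3.5 (𝓛_{xy}, piecewise affine paths from x to y)] -/
def IsLoopAt (x : E2) (L : List Seg) : Prop :=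
  IsChain L ∧ (L.head?.map Seg.ini = some x) ∧ ∃ n : Fin 2 → ℤ, L.getLast?.map Seg.fin = some (x + intShift n)

/-- **Proposition 3.35 (gauge equivalence ⇔ conjugate holonomies).** Let `α ∈ (½, 1]` and
`A, Ā ∈ Ω_{α-gr}` (`𝔤`-valued). The following are equivalent: (1) `A ∼ Ā`; (2) there exist `x ∈ 𝕋²`
and `g₀ ∈ G` with `hol(Ā, γ) = g₀ hol(A, γ) g₀⁻¹` for all `γ ∈ 𝓛_{xx}`; (3) for every `x` there is
`g_x ∈ G` with the same property. Furthermore, under (2) the UNIQUE `g ∈ 𝔊^α` with `g(x) = g₀` and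
`A^g = Ā` is `g(y) = hol(Ā, γ_{xy})⁻¹ g₀ hol(A, γ_{xy})` for any piecewise affine `γ_{xy}` from `x` to
`y`, and `|g|_{α-Höl} ≲ |A|_{α-gr} + |Ā|_{α-gr}` (the bound is not transcribed). The existence of the
product-integral limits defining `hol` on `Ω_{α-gr}` (R4) is asserted as part of the fact.
[cite: ChandraChevyrevHairerShen2022YM2, Prop. 3.35 with eqs. (3.25), (3.29), (3.30)] -/
def gaugeEquiv_iff_holonomy : Prop :=
  ∀ (G : Type) [Group G] [TopologicalSpace G] [CompactSpace G] (r : LatticeRep G) (α : ℝ),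
    1 / 2 < α → α ≤ 1 →
    ∀ A ∈ OmegaGr r.N α, ∀ A' ∈ OmegaGr r.N α,
      LineFn.ValuedIn r.lieAlg A → LineFn.ValuedIn r.lieAlg A' →
      (∀ ℓ : Seg, Tendsto (holApprox r A ℓ) atTop (𝓝 (hol r A ℓ))) ∧
      (GaugeEquiv r α A A' ↔
        ∃ (x : E2) (g₀ : G), ∀ L : List Seg, IsLoopAt x L →
          holChain r A' L = r.ρ g₀ * holChain r A L * star (r.ρ g₀)) ∧
      (GaugeEquiv r α A A' ↔
        ∀ x : E2, ∃ gx : G, ∀ L : List Seg, IsLoopAt x L →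
          holChain r A' L = r.ρ gx * holChain r A L * star (r.ρ gx)) ∧
      (∀ (x : E2) (g₀ : G), (∀ L : List Seg, IsLoopAt x L →
          holChain r A' L = r.ρ g₀ * holChain r A L * star (r.ρ g₀)) →
        ∃ g ∈ GaugeGroup r α, g x = g₀ ∧ gaugeAct r g A = A' ∧
          (∀ g' ∈ GaugeGroup r α, g' x = g₀ → gaugeAct r g' A = A' → g' = g) ∧
          ∀ (y : E2) (L : List Seg), IsChain L → L.head?.map Seg.ini = some x →
            L.getLast?.map Seg.fin = some y →
            r.ρ (g y) = star (holChain r A' L) * r.ρ g₀ * holChain r A L)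

/-! ### §3.6 The orbit space -/

/-- The gauge orbit `[A] = {A^g : g ∈ 𝔊^{0,α}} ⊂ Ω¹_α` of `A`. [cite: ChandraChevyrevHairerShen2022YM2, Def. 3.37] -/
def orbit (α : ℝ) (A : LineFn r.N) : Set (LineFn r.N) := {B | ∃ g ∈ LittleGaugeGroup r α, gaugeAct r g A = B}

/-- **Theorem 3.27 with Corollary 3.36 (the action of `𝔊^{0,α}` on `Ω¹_α`) = Thm 2.1 (iii), first
part.** For `α ∈ (2/3, 1]` and `𝔤`-valued `A ∈ Ω¹_α`, `g, h ∈ 𝔊^{0,α}`: the Young–Riemann limits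
defining `A^g` exist and `A^g ∈ Ω¹_α`; `A^1 = A` and `(A^h)^g = A^{gh}` (left group action); and
`(A, g) ↦ A^g` is continuous `Ω¹_α × 𝔊^{0,α} → Ω¹_α` (print: uniformly continuous on every ball; the
same holds on `Ω¹_{α-gr}`, not transcribed). [cite: ChandraChevyrevHairerShen2022YM2, Thm 3.27 and Cor. 3.36; Thm 2.1 (iii)] -/
def gaugeAction_omega1 : Prop :=
  ∀ (G : Type) [Group G] [TopologicalSpace G] [CompactSpace G] (r : LatticeRep G) (α : ℝ),
    2 / 3 < α → α ≤ 1 →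
    (∀ A ∈ Omega1 r.lieAlg α, ∀ g ∈ LittleGaugeGroup r α,
      (∀ ℓ : Seg, Tendsto (gaugeActSum r g A ℓ) atTop (𝓝 (gaugeAct r g A ℓ))) ∧
        gaugeAct r g A ∈ Omega1 r.lieAlg α) ∧
    (∀ A ∈ Omega1 r.lieAlg α, gaugeAct r (fun _ => (1 : G)) A = A) ∧
    (∀ A ∈ Omega1 r.lieAlg α, ∀ g ∈ LittleGaugeGroup r α, ∀ h ∈ LittleGaugeGroup r α,
      gaugeAct r g (gaugeAct r h A) = gaugeAct r (g * h) A) ∧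
    (∀ A ∈ Omega1 r.lieAlg α, ∀ g ∈ LittleGaugeGroup r α, ∀ ε : ℝ, 0 < ε → ∃ δ : ℝ, 0 < δ ∧
      ∀ A' ∈ Omega1 r.lieAlg α, ∀ g' ∈ LittleGaugeGroup r α,
        alphaNorm α (A - A') < ENNReal.ofReal δ → gaugeDist r α g g' < ENNReal.ofReal δ →
          alphaNorm α (gaugeAct r g A - gaugeAct r g' A') < ENNReal.ofReal ε)

/-- **Theorem 2.1 (iv) (with Props 3.35, 3.39): gauge orbits in `𝔒_α` are determined by conjugacy
classes of holonomies along loops.** For `α ∈ (2/3, 1]` and `𝔤`-valued `A, Ā ∈ Ω¹_α`: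
`Ā ∈ [A]` iff for some (equivalently every) base point `x` there is `g₀ ∈ G` with
`hol(Ā, γ) = g₀ hol(A, γ) g₀⁻¹` for all `γ ∈ 𝓛_{xx}`. (Prop. 3.39: a `g ∈ 𝔊^α` with `A^g ∈ Ω¹_{α-gr}`
lies in `𝔊^{0,α}`, so `∼` and the `𝔊^{0,α}`-orbits agree on `Ω¹_α`.)
[cite: ChandraChevyrevHairerShen2022YM2, Thm 2.1 (iv), Prop. 3.35, Prop. 3.39] -/
def orbit_iff_holonomy : Prop :=
  ∀ (G : Type) [Group G] [TopologicalSpace G] [CompactSpace G] (r : LatticeRep G) (α : ℝ),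
    2 / 3 < α → α ≤ 1 →
    ∀ A ∈ Omega1 r.lieAlg α, ∀ A' ∈ Omega1 r.lieAlg α,
      (A' ∈ orbit r α A ↔
        ∃ (x : E2) (g₀ : G), ∀ L : List Seg, IsLoopAt x L →
          holChain r A' L = r.ρ g₀ * holChain r A L * star (r.ρ g₀)) ∧
      (A' ∈ orbit r α A ↔ GaugeEquiv r α A A')

/-- **Lemma 3.40.** For `α ∈ (2/3, 1]` every gauge orbit `[A]`, `A ∈ Ω¹_α`, is closed in `Ω¹_α`.
[cite: ChandraChevyrevHairerShen2022YM2, Lemma 3.40] -/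
def orbits_closed : Prop :=
  ∀ (G : Type) [Group G] [TopologicalSpace G] [CompactSpace G] (r : LatticeRep G) (α : ℝ),
    2 / 3 < α → α ≤ 1 →
    ∀ A ∈ Omega1 r.lieAlg α, ∀ (B : ℕ → LineFn r.N) (B' : LineFn r.N),
      (∀ n, B n ∈ orbit r α A) → B' ∈ Omega1 r.lieAlg α →
        Tendsto (fun n => alphaNorm α (B n - B')) atTop (𝓝 0) → B' ∈ orbit r α A

/-- The function `K(A, B) = |‖A‖ − ‖B‖| + (‖A − B‖ ∧ 1) / ((‖A‖ ∧ ‖B‖) + 1)` on the Banach space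
`(Ω¹_α, |·|_α)` (R5: reading of the garbled display). [cite: ChandraChevyrevHairerShen2022YM2, Def. 3.41 with (3.34)–(3.36)] -/
def bigK (α : ℝ) (A B : LineFn r.N) : ℝ :=
  |(alphaNorm α A).toReal - (alphaNorm α B).toReal| +
    min (alphaNorm α (A - B)).toReal 1 / (min (alphaNorm α A).toReal (alphaNorm α B).toReal + 1)

/-- The cost `∑_i K(Z_{i-1}, Z_i)` of a finite chain `Z_0, …, Z_n`. [cite: ChandraChevyrevHairerShen2022YM2, Def. 3.41 eq. (3.33)] -/
def chainCost (α : ℝ) : List (LineFn r.N) → ℝ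
  | [] => 0
  | [_] => 0
  | A :: B :: L => bigK r α A B + chainCost α (B :: L)

/-- The metric `k_α(A, B) = inf ∑_{i=1}^n K(Z_{i-1}, Z_i)` over finite chains `Z_0 = A, …, Z_n = B` in
`Ω¹_α` (complete, same topology as `|·|_α`: Prop. 3.43). [cite: ChandraChevyrevHairerShen2022YM2, Def. 3.41 eq. (3.33)] -/
def kMetric (α : ℝ) (A B : LineFn r.N) : ℝ :=
  ⨅ L : {L : List (LineFn r.N) // ∀ Z ∈ L, Z ∈ Omega1 r.lieAlg α}, chainCost r α (A :: (L.1 ++ [B]))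

/-- **`D_α([A], [B])`**: the Hausdorff distance between the orbits `[A]`, `[B]` for the metric `k_α`
(as a function of representatives; extended-valued, R3). [cite: ChandraChevyrevHairerShen2022YM2, Def. 3.44] -/
def orbitEDist (α : ℝ) (A B : LineFn r.N) : ℝ≥0∞ :=
  max (⨆ a ∈ orbit r α A, ⨅ b ∈ orbit r α B, ENNReal.ofReal (kMetric r α a b))
      (⨆ b ∈ orbit r α B, ⨅ a ∈ orbit r α A, ENNReal.ofReal (kMetric r α a b))

/-- **Theorem 3.45 (the orbit space `𝔒_α = Ω¹_α/𝔊^{0,α}` is Polish) = Thm 2.1 (iii), metric part.**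
For `α ∈ (2/3, 1]` (`𝔤`-valued forms): `D_α` is a finite pseudometric on `Ω¹_α` whose zero set is
exactly "same orbit" (orbits are closed, Lemma 3.40), hence a metric on `𝔒_α`; it is complete; it
metrises the quotient topology (a `𝔊^{0,α}`-saturated subset of `Ω¹_α` is open for `|·|_α` iff it
is `D_α`-open); and `𝔒_α` is separable — "in particular, `𝔒_α` is a Polish space". (The same for
`(𝔒_{α-gr}, D_{α-gr})`, not transcribed.) [cite: ChandraChevyrevHairerShen2022YM2, Thm 3.45 and Def. 3.44; Thm 2.1 (iii)] -/
def orbitSpace_polish : Prop :=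
  ∀ (G : Type) [Group G] [TopologicalSpace G] [CompactSpace G] (r : LatticeRep G) (α : ℝ),
    2 / 3 < α → α ≤ 1 →
    -- finite, symmetric, triangle inequality, zero set = orbits
    (∀ A ∈ Omega1 r.lieAlg α, ∀ B ∈ Omega1 r.lieAlg α,
        orbitEDist r α A B < ∞ ∧ orbitEDist r α A B = orbitEDist r α B A ∧
        (orbitEDist r α A B = 0 ↔ B ∈ orbit r α A) ∧
        ∀ C ∈ Omega1 r.lieAlg α, orbitEDist r α A C ≤ orbitEDist r α A B + orbitEDist r α B C) ∧
    -- completeness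
    (∀ A : ℕ → LineFn r.N, (∀ n, A n ∈ Omega1 r.lieAlg α) →
      (∀ ε : ℝ, 0 < ε → ∃ n₀ : ℕ, ∀ m n, n₀ ≤ m → n₀ ≤ n → orbitEDist r α (A m) (A n) < ENNReal.ofReal ε) →
        ∃ B ∈ Omega1 r.lieAlg α, Tendsto (fun n => orbitEDist r α (A n) B) atTop (𝓝 0)) ∧
    -- `D_α` metrises the quotient topology of `Ω¹_α / 𝔊^{0,α}`
    (∀ U : Set (LineFn r.N), U ⊆ Omega1 r.lieAlg α → (∀ A ∈ U, orbit r α A ⊆ U) →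
      ((∀ A ∈ U, ∃ ε : ℝ, 0 < ε ∧ ∀ B ∈ Omega1 r.lieAlg α,
          alphaNorm α (A - B) < ENNReal.ofReal ε → B ∈ U) ↔
        (∀ A ∈ U, ∃ ε : ℝ, 0 < ε ∧ ∀ B ∈ Omega1 r.lieAlg α,
          orbitEDist r α A B < ENNReal.ofReal ε → B ∈ U))) ∧
    -- separability
    (∃ S : Set (LineFn r.N), S.Countable ∧ S ⊆ Omega1 r.lieAlg α ∧
      ∀ A ∈ Omega1 r.lieAlg α, ∀ ε : ℝ, 0 < ε → ∃ B ∈ S, orbitEDist r α A B < ENNReal.ofReal ε)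

/-! ### Theorem 2.1 (i): holonomies along `C^{1,β}` curves -/

/-- `γ : [0,1] → 𝕋²` (in the cover) is of class `C^{1,β}` with `|γ̇|_∞ + |γ̇|_{β-Höl} ≤ R` (a ball of
`C^{1,β}`, (3.20)) and has diameter `≤ 1/4` (R6). [cite: ChandraChevyrevHairerShen2022YM2, §3.2 (C^{1,β}([0,1], 𝕋²) and eq. (3.20)) and Thm 2.1 (i)] -/
def IsC1HolderCurve (β R : ℝ) (γ : ℝ → E2) : Prop :=
  ∃ (γ' : ℝ → E2) (M₀ M₁ : ℝ),
    (∀ t ∈ Set.Icc (0 : ℝ) 1, HasDerivWithinAt γ (γ' t) (Set.Icc (0 : ℝ) 1) t) ∧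
    (∀ t ∈ Set.Icc (0 : ℝ) 1, ‖γ' t‖ ≤ M₀) ∧
    (∀ s ∈ Set.Icc (0 : ℝ) 1, ∀ t ∈ Set.Icc (0 : ℝ) 1, ‖γ' t - γ' s‖ ≤ M₁ * |t - s| ^ β) ∧
    0 ≤ M₀ ∧ 0 ≤ M₁ ∧ M₀ + M₁ ≤ R ∧
    ∀ s ∈ Set.Icc (0 : ℝ) 1, ∀ t ∈ Set.Icc (0 : ℝ) 1, ‖γ t - γ s‖ ≤ (1 : ℝ) / 4

/-- The `k`-th chord of `γ` over the uniform partition into `n + 1` pieces, as a segment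
`(γ(t_k), γ(t_{k+1}) − γ(t_k))`, `t_k = k/(n+1)` (junk: the degenerate segment if the chord is longer
than `1/4`, which does not happen for curves of diameter `≤ 1/4`; classical case distinction).
[cite: ChandraChevyrevHairerShen2022YM2, §3.2 (the piecewise affine interpolation γ^D)] -/
def chordSeg (γ : ℝ → E2) (n k : ℕ) : Seg :=
  @dite Seg (‖γ (((k : ℝ) + 1) / ((n : ℝ) + 1)) - γ ((k : ℝ) / ((n : ℝ) + 1))‖ ≤ (1 : ℝ) / 4)
    (Classical.dec _)
    (fun h => ⟨(γ ((k : ℝ) / ((n : ℝ) + 1)),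
      γ (((k : ℝ) + 1) / ((n : ℝ) + 1)) - γ ((k : ℝ) / ((n : ℝ) + 1))), h⟩)
    (fun _ => Seg.degenerate (γ ((k : ℝ) / ((n : ℝ) + 1))))

/-- `hol(A, γ^{D_n})`: holonomy of the piecewise affine interpolation of `γ` along the uniform
partition into `n + 1` pieces. [cite: ChandraChevyrevHairerShen2022YM2, §3.5 with Def. 3.15] -/
def pathHolApprox (A : LineFn r.N) (γ : ℝ → E2) (n : ℕ) : Matrix (Fin r.N) (Fin r.N) ℂ :=
  holChain r A ((List.range (n + 1)).map fun k => chordSeg γ n k)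

/-- **`hol(A, γ)`** for a curve `γ` (of diameter `≤ 1/4`): the limit of `hol(A, γ^{D_n})` (R4, R6).
-- TODO(general form): curves of larger diameter by concatenation.
[cite: ChandraChevyrevHairerShen2022YM2, Thm 2.1 (i), Def. 3.15, Rem. 3.34] -/
def pathHol (A : LineFn r.N) (γ : ℝ → E2) : Matrix (Fin r.N) (Fin r.N) ℂ :=
  limUnder atTop (pathHolApprox r A γ)

/-- **Theorem 2.1 (i).** For `α ∈ (2/3, 1)`, `β ∈ (2/α − 2, 1]`, `A ∈ Ω¹_α` (`𝔤`-valued) and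
`γ ∈ C^{1,β}([0,1], 𝕋²)`, the holonomy `hol(A, γ) ∈ G` is well defined (the limits defining it exist)
and, on bounded balls of `Ω¹_α × C^{1,β}`, is a Hölder continuous function of `(A, γ)` with distances
between `γ`'s measured in the supremum metric — "in particular, Wilson loop observables are well
defined on `Ω¹_α`". [cite: ChandraChevyrevHairerShen2022YM2, Thm 2.1 (i) (with Thm 3.18, Prop. 3.21)] -/
def holonomy_holderContinuous : Prop :=
  ∀ (G : Type) [Group G] [TopologicalSpace G] [CompactSpace G] (r : LatticeRep G) (α : ℝ),
    2 / 3 < α → α < 1 →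
    ∀ β : ℝ, 2 / α - 2 < β → β ≤ 1 → ∀ R : ℝ, 0 < R →
      ∃ (C θ : ℝ), 0 < C ∧ 0 < θ ∧
        ∀ A ∈ Omega1 r.lieAlg α, ∀ A' ∈ Omega1 r.lieAlg α,
          alphaNorm α A ≤ ENNReal.ofReal R → alphaNorm α A' ≤ ENNReal.ofReal R →
          ∀ γ γ' : ℝ → E2, IsC1HolderCurve β R γ → IsC1HolderCurve β R γ' →
            Tendsto (pathHolApprox r A γ) atTop (𝓝 (pathHol r A γ)) ∧
            pathHol r A γ ∈ Set.range r.ρ ∧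
            frobNorm (pathHol r A γ - pathHol r A' γ') ≤
              C * ((alphaNorm α (A - A')).toReal + ⨆ t : Set.Icc (0 : ℝ) 1, ‖γ t - γ' t‖) ^ θ

/-- **Theorem 2.1 (state space of the 2D Yang–Mills Langevin dynamic).** For each `α ∈ (2/3, 1)`
the Banach space `Ω¹_α` of distributional `𝔤`-valued `1`-forms on `𝕋²` has: (i) holonomies along
`C^{1,β}` curves, `β ∈ (2/α − 2, 1]`, Hölder continuous in `(A, γ)` on balls (Wilson loops are
defined); (ii) the embedding `ΩC^{0,α/2} ↪ Ω¹_α` (and `Ω¹_α ↪ ΩC^{0,α−1}`, not transcribed);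
(iii) a continuous action of `𝔊^{0,α}` and a complete separable metric `D_α` on
`𝔒_α = Ω¹_α/𝔊^{0,α}` inducing the quotient topology; (iv) orbits determined by conjugacy classes of
loop holonomies. Typed as the conjunction of the facts above (each carries the precise reference).
[cite: ChandraChevyrevHairerShen2022YM2, Thm 2.1] -/
def stateSpace2D : Prop :=
  holonomy_holderContinuous ∧ holderForms_embed ∧ gaugeAction_omega1 ∧ orbitSpace_polish ∧
    orbit_iff_holonomy

end Gauge

end Literature.MathematicalPhysics.QuantumFieldTheory.CCHS2024
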